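import Summits.AnomalousDissipation.AnomalousDissipation.Theorems.SawtoothPulseCascadeK1LocalisedCascadeCornerTraceRounding

/-!
# K1loc, line `Spectral` / thin start — helper: PER-FIBRE MINKOWSKI FOR A HALF-STEP («FibreMinkowski», phase-1 dischargers D2)

Helper file of the prover lane on the crux `K1LocalisedCascade` (stmt-AnomalousDissipation-19491), route `SawtoothPulseCascade`
(glue seat; arbiter A24-2 (2): trace-side scalars, start box, junk targets `j_H/j_V/j_O`; plan `PHASE1-DIRECT-SIZING-k1locp3g4.md` §4,
item D2).  On one fibre `kᵢ = n` a half-step `θ ↦ θ ∘ Φ` (`Φ = shearMap i j ψ`) is the convolution of the fibre coefficient sequence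
`c_q = 𝓕θ(…, q, …)` with the coefficients of the chirp `g_n = twist ψ n` (`Torus.mFourierCoeff_comp_shearMap`).  Splitting the sources
into a finite set `S` (treated one by one, Minkowski) and the rest (treated in `ℓ²`, Bessel), the window energy of the output obeys
  `√(Σ_{m∈W} ‖𝓕(θ∘Φ)(n,m)‖²) ≤ Σ_{q∈S} ‖c_q‖·√(Σ_{m∈W} ‖ĝ_n(m−q)‖²) + √(Σ'_{q∉S} ‖c_q‖²)`.
* `sum_window_sq_norm_trigPoly_conv_le`, **`sum_window_sq_norm_tsum_conv_le`**: the `ℓ²` CONTRACTION of the chirp convolution —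
  for `Σ_q ‖c_q‖ < ∞` and continuous `g` with `‖g‖ ≤ 1`, `Σ_{m∈W} ‖Σ'_q c_q ĝ(m−q)‖² ≤ Σ'_q ‖c_q‖²` (finite trigonometric polynomials:
  `𝓕(g·T) `, Bessel, `∫‖gT‖² ≤ ∫‖T‖²`; then the limit along finite sets);
* `sqrt_window_sq_norm_conv_le`: the sequence-level Minkowski + remainder bound;
* **`sqrt_window_sq_norm_hstep_le`** / **`sqrt_window_sq_norm_vstep_le`**: the cascade forms on `𝕋²` (H half-step: fibre `k₀ = n`,
  window in `k₁`; V half-step: fibre `k₁ = n`, window in `k₀`);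
* `tsum_slab_window_eq_sum`: the slab-window indicator series on `ℤ²` is the finite window sum (bookkeeping for the junk regions).
No definitions; nothing about the crux. [cite: Grafakos2014, Prop. 3.1.2 (5), Prop. 3.2.7 (3)] [problem: turb]
-/

-- `Summit.<Summit>.<Problem>`: single-conjunct summit, the duplicate namespace segment is deliberate.
set_option linter.dupNamespace false

noncomputable section

namespace Summit.AnomalousDissipation.AnomalousDissipation.Theorems.SawtoothPulseCascade.K1Window

open MeasureTheory Filter Topology UnitAddTorus Complex AddCircle
open scoped Real
open Literature.Analysis.FunctionSpaces Literature.Analysis.FunctionSpaces.Torus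
open Summit.AnomalousDissipation.AnomalousDissipation.Theorems.SawtoothPulseCascade.K1Start

/-! ## §1 The `ℓ²` contraction of the chirp convolution -/

/-- **A coefficient of a sub-unimodular function is at most one**: `‖g‖ ≤ 1` ⇒ `‖ĝ(k)‖ ≤ 1`. [cite: Grafakos2014, Prop. 3.2.7 (3)] -/
theorem norm_fourierCoeff_le_one {g : UnitAddCircle → ℂ} (hg : Continuous g) (hg1 : ∀ x, ‖g x‖ ≤ 1) (k : ℤ) :
    ‖fourierCoeff g k‖ ≤ 1 := by
  have h1 : ‖fourierCoeff g k‖ ^ 2 ≤ ∫ t, ‖g t‖ ^ 2 ∂haarAddCircle := by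
    have h := sum_sq_norm_fourierCoeff_le_integral_sq hg {k}
    simpa using h
  have h2 : ∫ t, ‖g t‖ ^ 2 ∂haarAddCircle ≤ ∫ _t : UnitAddCircle, (1 : ℝ) ∂haarAddCircle := by
    refine integral_mono_of_nonneg (Eventually.of_forall fun t => sq_nonneg _) (integrable_const _)
      (Eventually.of_forall fun t => ?_)
    have h0 : 0 ≤ ‖g t‖ := norm_nonneg _
    simpa using pow_le_one₀ h0 (hg1 t) (n := 2)
  have h3 : ∫ _t : UnitAddCircle, (1 : ℝ) ∂haarAddCircle = 1 := by simp
  rw [h3] at h2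
  have h4 : ‖fourierCoeff g k‖ ^ 2 ≤ 1 := h1.trans h2
  nlinarith [norm_nonneg (fourierCoeff g k)]

/-- **`ℓ²` contraction, finite sources**: for continuous `g` with `‖g‖ ≤ 1`, coefficients `c` on a finite `T` and any finite window `W`,
`Σ_{m∈W} ‖Σ_{q∈T} c_q ĝ(m−q)‖² ≤ Σ_{q∈T} ‖c_q‖²` (`Σ_q c_q ĝ(m−q) = 𝓕(g·T)(m)` for `T = Σ_q c_q e_q`; Bessel; `∫‖gT‖² ≤ ∫‖T‖² = Σ‖c_q‖²`).
[cite: Grafakos2014, Prop. 3.1.2 (5), Prop. 3.2.7 (3)] -/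
theorem sum_window_sq_norm_trigPoly_conv_le {g : UnitAddCircle → ℂ} (hg : Continuous g) (hg1 : ∀ x, ‖g x‖ ≤ 1)
    (c : ℤ → ℂ) (T W : Finset ℤ) :
    ∑ m ∈ W, ‖∑ q ∈ T, c q * fourierCoeff g (m - q)‖ ^ 2 ≤ ∑ q ∈ T, ‖c q‖ ^ 2 := by
  set P : UnitAddCircle → ℂ := fun x => ∑ q ∈ T, c q * fourier q x with hP
  have hPc : Continuous P := continuous_finsetSum _ fun q _ => continuous_const.mul (fourier q).continuous
  set h : UnitAddCircle → ℂ := fun x => g x * P x with hh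
  have hhc : Continuous h := hg.mul hPc
  have e1 : ∀ m, ∑ q ∈ T, c q * fourierCoeff g (m - q) = fourierCoeff h m := fun m =>
    (fourierCoeff_mul_trigPoly hg c T m).symm
  simp_rw [e1]
  refine (sum_sq_norm_fourierCoeff_le_integral_sq hhc W).trans ?_
  rw [← integral_haar_norm_sq_trigPoly_eq T c]
  refine integral_mono_of_nonneg (Eventually.of_forall fun t => sq_nonneg _)
    ((hPc.norm.pow 2).integrable_of_hasCompactSupport (HasCompactSupport.of_compactSpace _))
    (Eventually.of_forall fun t => ?_)
  dsimp only
  rw [hh, norm_mul]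
  have h0 : 0 ≤ ‖P t‖ := norm_nonneg _
  have h1 : ‖g t‖ * ‖P t‖ ≤ 1 * ‖P t‖ := mul_le_mul_of_nonneg_right (hg1 t) h0
  rw [one_mul] at h1
  exact pow_le_pow_left₀ (by positivity) h1 2

/-- **THE `ℓ²` CONTRACTION OF THE CHIRP CONVOLUTION**: for `Σ_q ‖c_q‖ < ∞`, continuous `g` with `‖g‖ ≤ 1` and any finite window `W`,
`Σ_{m∈W} ‖Σ'_q c_q ĝ(m−q)‖² ≤ Σ'_q ‖c_q‖²` (the finite case along the filter of finite sets). [cite: Grafakos2014, Prop. 3.1.2 (5), Prop. 3.2.7 (3)] -/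
theorem sum_window_sq_norm_tsum_conv_le {g : UnitAddCircle → ℂ} (hg : Continuous g) (hg1 : ∀ x, ‖g x‖ ≤ 1)
    {c : ℤ → ℂ} (hc : Summable fun q => ‖c q‖) (W : Finset ℤ) :
    ∑ m ∈ W, ‖∑' q, c q * fourierCoeff g (m - q)‖ ^ 2 ≤ ∑' q, ‖c q‖ ^ 2 := by
  -- summability of the convolution series and of `‖c‖²`
  have hsc : ∀ m, Summable fun q => c q * fourierCoeff g (m - q) := fun m => by
    refine Summable.of_norm_bounded hc fun q => ?_
    rw [norm_mul]
    exact mul_le_of_le_one_right (norm_nonneg _) (norm_fourierCoeff_le_one hg hg1 _)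
  have hA : ∀ q, ‖c q‖ ≤ ∑' q, ‖c q‖ := fun q => hc.le_tsum q fun _ _ => norm_nonneg _
  have hc2 : Summable fun q => ‖c q‖ ^ 2 := by
    refine Summable.of_nonneg_of_le (fun q => sq_nonneg _) (fun q => ?_) (hc.mul_left (∑' q, ‖c q‖))
    rw [sq]
    exact mul_le_mul_of_nonneg_right (hA q) (norm_nonneg _)
  -- the two limits along `Finset ℤ`
  have hlim1 : Tendsto (fun T : Finset ℤ => ∑ m ∈ W, ‖∑ q ∈ T, c q * fourierCoeff g (m - q)‖ ^ 2) atTop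
      (𝓝 (∑ m ∈ W, ‖∑' q, c q * fourierCoeff g (m - q)‖ ^ 2)) := by
    refine tendsto_finsetSum W fun m _ => ?_
    exact ((hsc m).hasSum.norm).pow 2
  have hlim2 : Tendsto (fun T : Finset ℤ => ∑ q ∈ T, ‖c q‖ ^ 2) atTop (𝓝 (∑' q, ‖c q‖ ^ 2)) := hc2.hasSum
  exact le_of_tendsto_of_tendsto' hlim1 hlim2 fun T => sum_window_sq_norm_trigPoly_conv_le hg hg1 c T W

/-! ## §2 Minkowski on the finite sources, `ℓ²` on the rest -/

/-- Splitting a norm-summable series at a finite set: `Σ'_q f q = Σ_{q∈S} f q + Σ'_q [q ∉ S] f q`. [folklore] -/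
theorem tsum_eq_sum_add_tsum_compl {f : ℤ → ℂ} (hf : Summable f) (S : Finset ℤ) :
    ∑' q, f q = ∑ q ∈ S, f q + ∑' q, (if q ∈ S then 0 else f q) := by
  classical
  have h1 : Summable fun q => if q ∈ S then f q else 0 := summable_of_ne_finset_zero (s := S) fun q hq => if_neg hq
  have h2 : Summable fun q => if q ∈ S then 0 else f q := by
    refine (hf.sub h1).congr fun q => ?_
    by_cases hq : q ∈ S <;> simp [hq]
  have e : ∀ q, f q = (if q ∈ S then f q else 0) + (if q ∈ S then 0 else f q) := fun q => by
    by_cases hq : q ∈ S <;> simp [hq]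
  rw [tsum_congr e, h1.tsum_add h2, tsum_eq_sum (s := S) fun q hq => if_neg hq]
  congr 1
  exact Finset.sum_congr rfl fun q hq => if_pos hq

/-- **PER-FIBRE MINKOWSKI, SEQUENCE FORM**: for `Σ_q ‖c_q‖ < ∞`, continuous `g` with `‖g‖ ≤ 1`, finite `S`, `W`:
`√(Σ_{m∈W} ‖Σ'_q c_q ĝ(m−q)‖²) ≤ Σ_{q∈S} ‖c_q‖·√(Σ_{m∈W} ‖ĝ(m−q)‖²) + √(Σ'_q [q ∉ S] ‖c_q‖²)`.
[cite: Grafakos2014, Prop. 3.1.2 (5), Prop. 3.2.7 (3)] -/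
theorem sqrt_window_sq_norm_conv_le {g : UnitAddCircle → ℂ} (hg : Continuous g) (hg1 : ∀ x, ‖g x‖ ≤ 1)
    {c : ℤ → ℂ} (hc : Summable fun q => ‖c q‖) (S W : Finset ℤ) :
    Real.sqrt (∑ m ∈ W, ‖∑' q, c q * fourierCoeff g (m - q)‖ ^ 2) ≤
      ∑ q ∈ S, ‖c q‖ * Real.sqrt (∑ m ∈ W, ‖fourierCoeff g (m - q)‖ ^ 2) +
        Real.sqrt (∑' q, (if q ∈ S then 0 else ‖c q‖ ^ 2)) := by
  classical
  -- the finite part and the remainder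
  set cR : ℤ → ℂ := fun q => if q ∈ S then 0 else c q with hcR
  have hcRs : Summable fun q => ‖cR q‖ := by
    refine Summable.of_nonneg_of_le (fun q => norm_nonneg _) (fun q => ?_) hc
    by_cases hq : q ∈ S <;> simp [hcR, hq]
  have hsc : ∀ m, Summable fun q => c q * fourierCoeff g (m - q) := fun m => by
    refine Summable.of_norm_bounded hc fun q => ?_
    rw [norm_mul]
    exact mul_le_of_le_one_right (norm_nonneg _) (norm_fourierCoeff_le_one hg hg1 _)
  have hsplit : ∀ m, ∑' q, c q * fourierCoeff g (m - q) =
      ∑ q ∈ S, c q * fourierCoeff g (m - q) + ∑' q, cR q * fourierCoeff g (m - q) := by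
    intro m
    rw [tsum_eq_sum_add_tsum_compl (hsc m) S]
    congr 1
    refine tsum_congr fun q => ?_
    by_cases hq : q ∈ S <;> simp [hcR, hq]
  -- `ℓ²(W)` triangle inequality
  have htri := sqrt_sum_sq_le_sqrt_add_sqrt W (fun m => ∑' q, c q * fourierCoeff g (m - q))
    (fun m => ∑ q ∈ S, c q * fourierCoeff g (m - q))
  have hdiff : ∀ m, ∑' q, c q * fourierCoeff g (m - q) - ∑ q ∈ S, c q * fourierCoeff g (m - q) =
      ∑' q, cR q * fourierCoeff g (m - q) := fun m => by rw [hsplit m]; ring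
  simp only [hdiff] at htri
  -- Minkowski over the finite sources
  have hM : Real.sqrt (∑ m ∈ W, ‖∑ q ∈ S, c q * fourierCoeff g (m - q)‖ ^ 2) ≤
      ∑ q ∈ S, ‖c q‖ * Real.sqrt (∑ m ∈ W, ‖fourierCoeff g (m - q)‖ ^ 2) := by
    have h := sq_sum_norm_sum_le S W (fun q m => c q * fourierCoeff g (m - q))
    have h0 : 0 ≤ ∑ q ∈ S, Real.sqrt (∑ m ∈ W, ‖c q * fourierCoeff g (m - q)‖ ^ 2) :=
      Finset.sum_nonneg fun q _ => Real.sqrt_nonneg _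
    have h1 : Real.sqrt (∑ m ∈ W, ‖∑ q ∈ S, c q * fourierCoeff g (m - q)‖ ^ 2) ≤
        ∑ q ∈ S, Real.sqrt (∑ m ∈ W, ‖c q * fourierCoeff g (m - q)‖ ^ 2) := by
      rw [← Real.sqrt_sq h0]
      exact Real.sqrt_le_sqrt h
    refine h1.trans (le_of_eq (Finset.sum_congr rfl fun q _ => ?_))
    have e : ∑ m ∈ W, ‖c q * fourierCoeff g (m - q)‖ ^ 2 = ‖c q‖ ^ 2 * ∑ m ∈ W, ‖fourierCoeff g (m - q)‖ ^ 2 := by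
      rw [Finset.mul_sum]
      exact Finset.sum_congr rfl fun m _ => by rw [norm_mul, mul_pow]
    rw [e, Real.sqrt_mul (sq_nonneg _), Real.sqrt_sq (norm_nonneg _)]
  -- the remainder by the `ℓ²` contraction
  have hR : Real.sqrt (∑ m ∈ W, ‖∑' q, cR q * fourierCoeff g (m - q)‖ ^ 2) ≤
      Real.sqrt (∑' q, (if q ∈ S then 0 else ‖c q‖ ^ 2)) := by
    refine Real.sqrt_le_sqrt ((sum_window_sq_norm_tsum_conv_le hg hg1 hcRs W).trans (le_of_eq (tsum_congr fun q => ?_)))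
    by_cases hq : q ∈ S <;> simp [hcR, hq]
  exact htri.trans (add_le_add hM hR)

/-! ## §3 The cascade forms on `𝕋²` -/

/-- `![n, m] − m′e₁ = ![n, m − m′]`. [folklore] -/
theorem vecCons_sub_single_one (n m m' : ℤ) : (![n, m] : Fin 2 → ℤ) - Pi.single 1 m' = ![n, m - m'] := by
  ext i; fin_cases i <;> simp

/-- `![m, n] − m′e₀ = ![m − m′, n]`. [folklore] -/
theorem vecCons_sub_single_zero (n m m' : ℤ) : (![m, n] : Fin 2 → ℤ) - Pi.single 0 m' = ![m - m', n] := by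
  ext i; fin_cases i <;> simp

/-- **The H half-step on one fibre, as a convolution**: for continuous `θ : 𝕋² → ℂ` with `Σ‖𝓕θ‖ < ∞` and `b = θ ∘ shearMap 0 1 ψ`,
`𝓕b(n, m) = Σ'_q 𝓕θ(n, q)·ĝ_n(m − q)`, `ĝ_n = 𝓕(twist ψ n)`. [cite: Grafakos2014, Prop. 3.1.2 (5)] -/
theorem mFourierCoeff_hstep_fibre {θ : UnitAddTorus (Fin 2) → ℂ} (hθ : Continuous θ)
    (hsum : Summable fun k => ‖mFourierCoeff θ k‖) (ψ : ShearProfile) (n m : ℤ) :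
    mFourierCoeff (θ ∘ shearMap 0 1 ψ) ![n, m] =
      ∑' q, mFourierCoeff θ ![n, q] * fourierCoeff (twist ψ n) (m - q) := by
  rw [Torus.mFourierCoeff_comp_shearMap hθ hsum (show (0 : Fin 2) ≠ 1 by decide) ψ ![n, m]]
  simp only [Matrix.cons_val_zero, vecCons_sub_single_one]
  -- reindex `m′ ↦ q = m − m′`
  have he : (fun m' : ℤ => fourierCoeff (twist ψ n) m' * mFourierCoeff θ ![n, m - m']) =
      (fun q : ℤ => mFourierCoeff θ ![n, q] * fourierCoeff (twist ψ n) (m - q)) ∘ (fun m' : ℤ => m - m') := by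
    funext m'; simp only [Function.comp_apply, sub_sub_cancel]; ring
  rw [he]
  exact (Equiv.subLeft m).tsum_eq (fun q : ℤ => mFourierCoeff θ ![n, q] * fourierCoeff (twist ψ n) (m - q))

/-- **The V half-step on one fibre, as a convolution**: for continuous `θ : 𝕋² → ℂ` with `Σ‖𝓕θ‖ < ∞` and `a′ = θ ∘ shearMap 1 0 ψ`,
`𝓕a′(m, n) = Σ'_p 𝓕θ(p, n)·ĝ_n(m − p)`, `ĝ_n = 𝓕(twist ψ n)`. [cite: Grafakos2014, Prop. 3.1.2 (5)] -/
theorem mFourierCoeff_vstep_fibre {θ : UnitAddTorus (Fin 2) → ℂ} (hθ : Continuous θ)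
    (hsum : Summable fun k => ‖mFourierCoeff θ k‖) (ψ : ShearProfile) (n m : ℤ) :
    mFourierCoeff (θ ∘ shearMap 1 0 ψ) ![m, n] =
      ∑' p, mFourierCoeff θ ![p, n] * fourierCoeff (twist ψ n) (m - p) := by
  rw [Torus.mFourierCoeff_comp_shearMap hθ hsum (show (1 : Fin 2) ≠ 0 by decide) ψ ![m, n]]
  simp only [Matrix.cons_val_one, Matrix.cons_val_zero, vecCons_sub_single_zero]
  have he : (fun m' : ℤ => fourierCoeff (twist ψ n) m' * mFourierCoeff θ ![m - m', n]) =
      (fun p : ℤ => mFourierCoeff θ ![p, n] * fourierCoeff (twist ψ n) (m - p)) ∘ (fun m' : ℤ => m - m') := by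
    funext m'; simp only [Function.comp_apply, sub_sub_cancel]; ring
  rw [he]
  exact (Equiv.subLeft m).tsum_eq (fun p : ℤ => mFourierCoeff θ ![p, n] * fourierCoeff (twist ψ n) (m - p))

/-- **PER-FIBRE MINKOWSKI FOR THE H HALF-STEP**: for continuous `θ : 𝕋² → ℂ` with `Σ‖𝓕θ‖ < ∞`, `b = θ ∘ shearMap 0 1 ψ`, a fibre `n`,
a finite window `W` of vertical frequencies and a finite source set `S`:
`√(Σ_{m∈W} ‖𝓕b(n,m)‖²) ≤ Σ_{q∈S} ‖𝓕θ(n,q)‖·√(Σ_{m∈W} ‖ĝ_n(m−q)‖²) + √(Σ'_q [q ∉ S] ‖𝓕θ(n,q)‖²)`.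
[cite: Grafakos2014, Prop. 3.1.2 (5), Prop. 3.2.7 (3)] -/
theorem sqrt_window_sq_norm_hstep_le {θ : UnitAddTorus (Fin 2) → ℂ} (hθ : Continuous θ)
    (hsum : Summable fun k => ‖mFourierCoeff θ k‖) (ψ : ShearProfile) (n : ℤ) (S W : Finset ℤ) :
    Real.sqrt (∑ m ∈ W, ‖mFourierCoeff (θ ∘ shearMap 0 1 ψ) ![n, m]‖ ^ 2) ≤
      ∑ q ∈ S, ‖mFourierCoeff θ ![n, q]‖ * Real.sqrt (∑ m ∈ W, ‖fourierCoeff (twist ψ n) (m - q)‖ ^ 2) +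
        Real.sqrt (∑' q : ℤ, (if q ∈ S then 0 else ‖mFourierCoeff θ ![n, q]‖ ^ 2)) := by
  have hc : Summable fun q : ℤ => ‖mFourierCoeff θ ![n, q]‖ := by
    have hinj : Function.Injective (fun q : ℤ => (![n, q] : Fin 2 → ℤ)) := fun a b h => by
      have := congrFun h 1; simpa using this
    exact hsum.comp_injective hinj
  simp_rw [mFourierCoeff_hstep_fibre hθ hsum ψ n]
  exact sqrt_window_sq_norm_conv_le (continuous_twist ψ n) (fun x => (norm_twist ψ n x).le) hc S W

/-- **PER-FIBRE MINKOWSKI FOR THE V HALF-STEP**: for continuous `θ : 𝕋² → ℂ` with `Σ‖𝓕θ‖ < ∞`, `a′ = θ ∘ shearMap 1 0 ψ`, a fibre `n`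
(vertical frequency), a finite window `W` of horizontal frequencies and a finite source set `S`:
`√(Σ_{m∈W} ‖𝓕a′(m,n)‖²) ≤ Σ_{p∈S} ‖𝓕θ(p,n)‖·√(Σ_{m∈W} ‖ĝ_n(m−p)‖²) + √(Σ'_p [p ∉ S] ‖𝓕θ(p,n)‖²)`.
[cite: Grafakos2014, Prop. 3.1.2 (5), Prop. 3.2.7 (3)] -/
theorem sqrt_window_sq_norm_vstep_le {θ : UnitAddTorus (Fin 2) → ℂ} (hθ : Continuous θ)
    (hsum : Summable fun k => ‖mFourierCoeff θ k‖) (ψ : ShearProfile) (n : ℤ) (S W : Finset ℤ) :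
    Real.sqrt (∑ m ∈ W, ‖mFourierCoeff (θ ∘ shearMap 1 0 ψ) ![m, n]‖ ^ 2) ≤
      ∑ p ∈ S, ‖mFourierCoeff θ ![p, n]‖ * Real.sqrt (∑ m ∈ W, ‖fourierCoeff (twist ψ n) (m - p)‖ ^ 2) +
        Real.sqrt (∑' p : ℤ, (if p ∈ S then 0 else ‖mFourierCoeff θ ![p, n]‖ ^ 2)) := by
  have hc : Summable fun p : ℤ => ‖mFourierCoeff θ ![p, n]‖ := by
    have hinj : Function.Injective (fun p : ℤ => (![p, n] : Fin 2 → ℤ)) := fun a b h => by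
      have := congrFun h 0; simpa using this
    exact hsum.comp_injective hinj
  simp_rw [mFourierCoeff_vstep_fibre hθ hsum ψ n]
  exact sqrt_window_sq_norm_conv_le (continuous_twist ψ n) (fun x => (norm_twist ψ n x).le) hc S W

/-! ## §4 Bookkeeping: slab × window indicator series are finite window sums -/

/-- **A horizontal slab × finite window on `ℤ²` is a finite sum**: for any `c : ℤ² → ℝ`, fibre `n` and finite `W`,
`Σ'_k [k₀ = n ∧ k₁ ∈ W] c(k) = Σ_{m∈W} c(n, m)`. [folklore] -/
theorem tsum_hslab_window_eq_sum (c : (Fin 2 → ℤ) → ℝ) (n : ℤ) (W : Finset ℤ) :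
    ∑' k : Fin 2 → ℤ, (if k 0 = n ∧ k 1 ∈ W then c k else 0) = ∑ m ∈ W, c ![n, m] := by
  classical
  have hinj : Function.Injective (fun m : ℤ => (![n, m] : Fin 2 → ℤ)) := fun a b h => by
    have := congrFun h 1; simpa using this
  rw [tsum_eq_sum (s := W.image fun m => ![n, m])]
  · rw [Finset.sum_image fun a _ b _ h => hinj h]
    refine Finset.sum_congr rfl fun m hm => ?_
    simp [hm]
  · intro k hk
    rw [Finset.mem_image] at hk
    split_ifs with h
    · exact absurd ⟨k 1, h.2, by ext i; fin_cases i <;> simp [h.1]⟩ hk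
    · rfl

/-- **A vertical slab × finite window on `ℤ²` is a finite sum**: `Σ'_k [k₁ = n ∧ k₀ ∈ W] c(k) = Σ_{m∈W} c(m, n)`. [folklore] -/
theorem tsum_vslab_window_eq_sum (c : (Fin 2 → ℤ) → ℝ) (n : ℤ) (W : Finset ℤ) :
    ∑' k : Fin 2 → ℤ, (if k 1 = n ∧ k 0 ∈ W then c k else 0) = ∑ m ∈ W, c ![m, n] := by
  classical
  have hinj : Function.Injective (fun m : ℤ => (![m, n] : Fin 2 → ℤ)) := fun a b h => by
    have := congrFun h 0; simpa using this
  rw [tsum_eq_sum (s := W.image fun m => ![m, n])]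
  · rw [Finset.sum_image fun a _ b _ h => hinj h]
    refine Finset.sum_congr rfl fun m hm => ?_
    simp [hm]
  · intro k hk
    rw [Finset.mem_image] at hk
    split_ifs with h
    · exact absurd ⟨k 0, h.2, by ext i; fin_cases i <;> simp [h.1]⟩ hk
    · rfl

/-- **The vertical line of a norm-square coefficient array off a finite set, as a slab series on `ℤ²`**:
`Σ'_q [q ∉ S] ‖𝓕θ(n,q)‖² = Σ'_k [k₀ = n ∧ k₁ ∉ S] ‖𝓕θ(k)‖²` (reindexing the slab `k₀ = n` by `k₁`). [folklore] -/
theorem tsum_line_compl_eq_tsum_hslab (c : (Fin 2 → ℤ) → ℝ) (n : ℤ) (S : Finset ℤ) :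
    ∑' q : ℤ, (if q ∈ S then 0 else c ![n, q]) = ∑' k : Fin 2 → ℤ, (if k 0 = n ∧ k 1 ∉ S then c k else 0) := by
  classical
  have hinj : Function.Injective (fun q : ℤ => (![n, q] : Fin 2 → ℤ)) := fun a b h => by
    have := congrFun h 1; simpa using this
  set F : (Fin 2 → ℤ) → ℝ := fun k => if k 0 = n ∧ k 1 ∉ S then c k else 0 with hF
  have hsupp : Function.support F ⊆ Set.range (fun q : ℤ => (![n, q] : Fin 2 → ℤ)) := by
    intro k hk
    rw [Function.mem_support] at hk
    have h1 : k 0 = n := by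
      by_contra h; exact hk (by simp [hF, h])
    exact ⟨k 1, by ext i; fin_cases i <;> simp [h1]⟩
  rw [← hinj.tsum_eq hsupp]
  refine tsum_congr fun q => ?_
  by_cases hq : q ∈ S <;> simp [hF, hq]

end Summit.AnomalousDissipation.AnomalousDissipation.Theorems.SawtoothPulseCascade.K1Window
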